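import Literature.Barriers.BirchSwinnertonDyer.PAdicFunctionalEquationParityProofs
import Literature.NumberTheory.EllipticCurves.BSDSelmer
import Literature.NumberTheory.EllipticCurves.LeadingTerm

/-!
# BirchSwinnertonDyer / PAdicOrderV2 — crux `PAdicOrderPadicBSDrankR2` (stmt-0490), line `Sketch`,
# stub `stub_padicBSDrank_knownCases`: the known special cases of the open residues (odd `p`)

Registered stub of the skeleton `Cruxes/PAdicOrderPadicBSDrankR2/Lines/Sketch.lean` (idea
`pconverse-corank-split`). For `E/ℚ` (globally minimal `W`), an odd good ordinary prime `p` and the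
newform `f ∈ S₂(Γ₀(N))` of `E`, with `L_p(E,T) = padicLFunction f (unitRoot W p) ∈ ℚ_p⟦T⟧`, the two
special cases of the open residues of the line that ARE in print:

* (a) *level two under a rank-zero `p`-converse at the point.* Granting, at the point `(E,p,f)`,
  Kato's bound `corank_{ℤ_p} Sel_{p^∞}(E/ℚ) ≤ ord_{T=0} L_p(E,T)` (Kato 2004, Thm. 18.4), the
  `p`-parity theorem `corank ≡ ord_{s=1} L(E,s) (mod 2)` (Dokchitser–Dokchitser 2010, Thm. 1.4),
  Carayol's `N = N_E`, the level-zero implication `r_an = 0 ⇒ ord_T L_p = 0` and the rank-zero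
  `p`-converse `corank = 0 ⇒ r_an = 0` (Skinner–Urban 2014, Thm. 2 (b)):
  `ord_{T=0} L_p(E,T) = 2 ⇒ corank_{ℤ_p} Sel_{p^∞}(E/ℚ) = 2`.
* (b) *the Ш-side at corank one.* Granting Burungale–Skinner–Tian–Wan 2024, Thm. 1.10
  (`corank = 1 ⇒ r_an = 1` under (sur_ℚ) and (ram)) and Gross–Zagier–Kolyvagin
  (`r_an ≤ 1 ⇒ rank = r_an ∧ Ш finite`): `corank = 1 ⇒ rank E(ℚ) = 1 ∧ Ш(E/ℚ)` finite.

Proof. (a) Substitute `N = N_E`; at the conductor level the `p`-adic functional equation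
(Mazur–Tate–Teitelbaum 1986, §I.17) and complex parity are tree theorems, whence
`ord_T L_p ≡ r_an (mod 2)` (`even_order_padicLFunction_iff_even_analyticRank_conductorLevel`,
Greenberg LNM 1716, §5, p. 181). So `r_an` is even, hence `corank` is even by `p`-parity;
`corank ≤ 2` by Kato; and `corank ≠ 0`, for `corank = 0 ⇒ r_an = 0 ⇒ ord_T L_p = 0 ≠ 2`.
Hence `corank = 2`. (b) The two granted facts compose: `corank = 1 ⇒ r_an = 1 ≤ 1 ⇒
rank = r_an = 1 ∧ Ш finite`.
-/

-- D-0017: single-problem summit, so `Summit.BirchSwinnertonDyer.BirchSwinnertonDyer.…` repeats a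
-- namespace BY DESIGN.
set_option linter.dupNamespace false

namespace Summit.BirchSwinnertonDyer.BirchSwinnertonDyer.Theorems

open scoped MatrixGroups ModularForm
open CongruenceSubgroup Literature.NumberTheory.EllipticCurves
  Literature.NumberTheory.EllipticCurves.ModularForms

/-- **Stub (known special cases of the open residues; odd `p`).**
(a) *Level two under a rank-zero `p`-converse at the point*: granting at `(E,p,f)` Kato's bound,
`p`-parity, Carayol, the level-zero implication `r_an = 0 ⇒ ord_T L_p = 0`, and the rank-zero
`p`-converse `corank Sel_{p^∞} = 0 ⇒ r_an = 0` (Skinner–Urban 2014 Thm 2(b): `L(E,1) = 0 ⇒ corank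
≥ 1`, for `p ≥ 3` good ordinary, `ρ̄_{E,p}` irreducible, some `ℓ ‖ N` with `ρ̄` ramified), one has
`ord_T L_p = 2 ⇒ corank = 2` (`corank ≤ 2`, even, `≠ 0`): `T`-semisimplicity is free at level 2.
(b) *The Ш-side at corank one*: granting Burungale–Skinner–Tian–Wan 2024 Thm 1.10 (`corank = 1 ⇒
r_an = 1` for `p ∤ 2N` ordinary, `ρ̄_{E,p}` surjective, some `ℓ ‖ N` with `ρ̄` ramified) and
Gross–Zagier–Kolyvagin (`r_an ≤ 1 ⇒ rank = r_an ∧ Ш finite`): `corank = 1 ⇒ rank E(ℚ) = 1 ∧ Ш(E/ℚ)`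
finite. [cite: SkinnerUrban2014, Thm. 2 (b)] [cite: BurungaleSkinnerTianWan2024, Thm. 1.10]
[cite: Darmon2004, Thm. 3.22] -/
theorem stub_padicBSDrank_knownCases :
    (∀ (W : WeierstrassCurve ℚ) [W.IsElliptic] [W.IsGloballyMinimal] (p : ℕ) [Fact p.Prime],
      p ≠ 2 → IsOrdinaryAt W p → ∀ {N : ℕ} [NeZero N] (f : CuspForm (Gamma0 N) 2), IsNewformOf W f →
      (W.selmerCorank p : ℕ∞) ≤ (padicLFunction f (unitRoot W p : ℚ_[p])).order →
      W.selmerCorank p % 2 = W.analyticRank % 2 →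
      N = W.conductorNorm ℤ →
      (W.analyticRank = 0 → (padicLFunction f (unitRoot W p : ℚ_[p])).order = 0) →
      (W.selmerCorank p = 0 → W.analyticRank = 0) →
      (padicLFunction f (unitRoot W p : ℚ_[p])).order = 2 → W.selmerCorank p = 2) ∧
    (burungaleSkinnerTianWan_analyticRank_eq_one_of_selmerCorank_eq_one →
      rank_eq_analyticRank_of_analyticRank_le_one →
      ∀ (W : WeierstrassCurve ℚ) [W.IsElliptic] [W.IsGloballyMinimal] (p : ℕ) [Fact p.Prime],
      p ≠ 2 → W.HasGoodReductionAtPrime p → ¬ (p : ℤ) ∣ W.frobeniusTrace p →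
      W.HasSurjectiveModNGaloisRep p →
      (∃ ℓ : ℕ, ∃ _ : Fact ℓ.Prime, ℓ ≠ p ∧ W.HasMultiplicativeReductionAtPrime ℓ ∧
        ¬ p ∣ padicValInt ℓ W.minimalDiscriminantInt) →
      W.selmerCorank p = 1 → W.mordellWeilRank = 1 ∧ Finite W.sha) := by
  refine ⟨?_, ?_⟩
  · intro W _ _ p _ hp hord N _ f hf hkato hpar hN hlz hconv h2
    subst hN
    have heven : Even W.analyticRank := by
      have hiff :=
        Literature.Barriers.BirchSwinnertonDyer.even_order_padicLFunction_iff_even_analyticRank_conductorLevel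
          hp hord hf
      rw [h2, ENat.toNat_ofNat] at hiff
      exact hiff.mp even_two
    have hle : W.selmerCorank p ≤ 2 := by
      rw [h2] at hkato
      exact_mod_cast hkato
    have h0 : W.analyticRank % 2 = 0 := Nat.even_iff.mp heven
    have hne : W.selmerCorank p ≠ 0 := by
      intro hc
      have h00 : (padicLFunction f (unitRoot W p : ℚ_[p])).order = 0 := hlz (hconv hc)
      rw [h00] at h2
      exact absurd h2 (by simp)
    omega
  · intro hBSTW hGZK W _ _ p _ hp hgood hord hsurj hram hc
    have h1 : W.analyticRank = 1 := hBSTW W p hp hgood hord hsurj hram hc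
    obtain ⟨hr, hsha⟩ := hGZK W h1.le
    exact ⟨hr.trans h1, hsha⟩

end Summit.BirchSwinnertonDyer.BirchSwinnertonDyer.Theorems
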